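import Literature.MathematicalPhysics.KineticTheory.InfiniteChainCurrentPositiveType
import Literature.MathematicalPhysics.KineticTheory.InfiniteChainTwoPointContinuity
import Literature.MathematicalPhysics.KineticTheory.InfiniteChainCorrelationContinuity
import Literature.MathematicalPhysics.KineticTheory.InfiniteChainGibbsInvariance
import Literature.MathematicalPhysics.KineticTheory.InfiniteChainShiftInvariantUniqueness
import Literature.MathematicalPhysics.KineticTheory.InfiniteChainEnergyDensityMoments
import Literature.MathematicalPhysics.KineticTheory.InfiniteChainCurrentMoments
import Literature.MathematicalPhysics.KineticTheory.ZeroWavenumberDataOfClustering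
import HarnessLib

/-!
# Stub `stub_twiceIntegratedContinuity` of line `Sketch` (crux `FibreCalculus`, stmt-AtomisticToContinuum-16011)

The twice-integrated local conservation law of the split-bond energy density along the canonical
Buttà–Marchioro dynamics of the pinned anharmonic chain in a shift- and momentum-reversal-invariant
DLR state: with `h_x = energyDensityZ`, `j_x = bondCurrentZ`, `S(x,t) = Cov(h_0, h_x ∘ φ_t)` and
`G(x,t) = ∫ j_0 (j_x ∘ φ_t) dμ`,
`S(x,t) − S(x,0) = ∫_{(0,t]} (t − u) (G(x+1,u) − 2 G(x,u) + G(x−1,u)) du` for `t ≥ 0`.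
Ingredients: the pathwise law `ḣ_x = j_{x−1} − j_x` (`IsSolution.hasDerivAt_energyDensityZ`) and the
fundamental theorem of calculus on the carrier; Fubini for the jointly measurable
`(s, σ) ↦ j_y(φ_s σ)` (continuous in `s` for every `σ`, the flow being the identity off the carrier);
stationarity and the everywhere group law; shift covariance of the current pair correlations;
momentum reversal (`h` even, `j` odd); and `∫₀ᵗ ∫₀ˢ F = ∫₀ᵗ (t − u) F(u) du`.
-/

noncomputable section

open MeasureTheory ProbabilityTheory Filter Topology Set Function
open Literature.MathematicalPhysics.KineticTheory.HeatConduction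

namespace Summit.AtomisticToContinuum.FouriersLaw.Theorems.FibreCalculusSketch

/-- `∫ |g · (k ∘ φ)| dν ≤ (∫ g² + ∫ k²)/2` for a `ν`-preserving `φ` and `g, k ∈ L²(ν)`. [folklore] -/
theorem tic_integral_abs_mul_comp_le {α : Type*} [MeasurableSpace α] {ν : Measure α} {φ : α → α}
    (hφ : MeasurePreserving φ ν ν) {g k : α → ℝ} (hk : Measurable k) (hg2 : MemLp g 2 ν)
    (hk2 : MemLp k 2 ν) :
    ∫ x, |g x * k (φ x)| ∂ν ≤ ((∫ x, g x ^ 2 ∂ν) + ∫ x, k x ^ 2 ∂ν) / 2 := by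
  have hgs : Integrable (fun x => g x ^ 2) ν := hg2.integrable_sq
  have hks : Integrable (fun x => k (φ x) ^ 2) ν := (hk2.comp_measurePreserving hφ).integrable_sq
  have hprod : Integrable (fun x => g x * k (φ x)) ν :=
    hg2.integrable_mul (hk2.comp_measurePreserving hφ)
  have hiso : ∫ x, k (φ x) ^ 2 ∂ν = ∫ x, k x ^ 2 ∂ν :=
    integral_comp_eq_of_measurePreserving hφ (hk.pow_const 2)
  calc ∫ x, |g x * k (φ x)| ∂ν ≤ ∫ x, (g x ^ 2 + k (φ x) ^ 2) / 2 ∂ν := by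
        refine integral_mono hprod.abs ((hgs.add hks).div_const 2) fun x => ?_
        dsimp only
        rw [abs_mul]
        have h := two_mul_le_add_sq |g x| |k (φ x)|
        rw [sq_abs, sq_abs] at h
        linarith
    _ = ((∫ x, g x ^ 2 ∂ν) + ∫ x, k x ^ 2 ∂ν) / 2 := by
        rw [integral_div, integral_add hgs hks, hiso]

/-- `∫₀ᵗ (∫₀ˢ F(u) du) ds = ∫₀ᵗ (t − u) F(u) du` for continuous `F` (integration by parts). [folklore] -/
theorem tic_integral_integral_eq_integral_sub_mul {F : ℝ → ℝ} (hF : Continuous F) (t : ℝ) :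
    ∫ s in (0:ℝ)..t, (∫ u in (0:ℝ)..s, F u) = ∫ u in (0:ℝ)..t, (t - u) * F u := by
  have hΦd : ∀ a, HasDerivAt (fun s => ∫ u in (0:ℝ)..s, F u) (F a) a := fun a =>
    (hF.integral_hasStrictDerivAt 0 a).hasDerivAt
  have h := intervalIntegral.integral_mul_deriv_eq_deriv_mul (a := 0) (b := t)
    (u := fun x => x - t) (u' := fun _ => (1:ℝ)) (v := fun s => ∫ u in (0:ℝ)..s, F u) (v' := F)
    (fun x _ => (hasDerivAt_id' x).sub_const t) (fun x _ => hΦd x)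
    intervalIntegrable_const (hF.intervalIntegrable 0 t)
  simp only [sub_self, zero_mul, one_mul, zero_sub, intervalIntegral.integral_same, mul_zero] at h
  calc ∫ s in (0:ℝ)..t, (∫ u in (0:ℝ)..s, F u) = -∫ x in (0:ℝ)..t, (x - t) * F x := by linarith
    _ = ∫ u in (0:ℝ)..t, (t - u) * F u := by
        rw [← intervalIntegral.integral_neg]
        congr 1
        funext r
        ring

variable {P : OscillatorChain} (D : InfiniteChainDynamics P) {μ : Measure ChainConfig}

/-- Stationarity with the everywhere group law of a flow that is the identity off `𝒳₀`:
`∫ f · (g ∘ φ_t) dμ = ∫ (f ∘ φ_{−t}) · g dμ` for measurable `f, g`. [folklore] -/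
theorem tic_integral_mul_comp_flow_eq (hD : D.PreservesMeasure μ) (hcar : D.carrier = P.bmGood)
    (hid : ∀ (t : ℝ) (σ : ChainConfig), σ ∉ P.bmGood → D.flow t σ = σ) {f g : ChainConfig → ℝ}
    (hf : Measurable f) (hg : Measurable g) (t : ℝ) :
    ∫ σ, f σ * g (D.flow t σ) ∂μ = ∫ σ, f (D.flow (-t) σ) * g σ ∂μ := by
  have hm : Measurable fun σ => f σ * g (D.flow t σ) := hf.mul (hg.comp (hD.2 t).measurable)
  have h := integral_comp_eq_of_measurePreserving (hD.2 (-t)) hm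
  beta_reduce at h
  rw [← h]
  refine integral_congr_ae (Eventually.of_forall fun σ => ?_)
  show f (D.flow (-t) σ) * g (D.flow t (D.flow (-t) σ)) = f (D.flow (-t) σ) * g σ
  rw [← D.flow_add_of_eq_id hcar hid, add_neg_cancel, D.flow_zero_of_eq_id hcar hid]

/-- Joint measurability of `(s, σ) ↦ j_z(φ_s σ)` for a measurable flow with carrier `𝒳₀` that is
the identity off `𝒳₀` (continuous in `s` for every `σ`, measurable in `σ`). [folklore] -/
theorem tic_measurable_uncurry_bondCurrentZ_flow (hcar : D.carrier = P.bmGood)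
    (hmeas : ∀ t : ℝ, Measurable (D.flow t))
    (hid : ∀ (t : ℝ) (σ : ChainConfig), σ ∉ P.bmGood → D.flow t σ = σ)
    (hVc : Continuous (deriv P.V)) (z : ℤ) :
    Measurable (Function.uncurry fun (s : ℝ) (σ : ChainConfig) => P.bondCurrentZ (D.flow s σ) z) := by
  refine measurable_uncurry_of_continuous_of_measurable (fun σ => ?_) fun s =>
    (measurable_bondCurrentZ P z).comp (hmeas s)
  by_cases hσ : σ ∈ P.bmGood
  · exact D.continuous_bondCurrentZ_flow hVc (by rw [hcar]; exact hσ) z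
  · simp only [hid _ σ hσ]
    exact continuous_const

/-- Integrability of `(s, σ) ↦ g(σ) k(φ_s σ)` on `(a, b] × Ω` for `g, k ∈ L²(μ)` and a jointly
measurable `(s, σ) ↦ k(φ_s σ)` (`∫ |g (k ∘ φ_s)| ≤ (‖g‖₂² + ‖k‖₂²)/2` uniformly in `s`). [folklore] -/
theorem tic_integrable_prod [IsFiniteMeasure μ] (hD : D.PreservesMeasure μ) {g k : ChainConfig → ℝ}
    (hg : Measurable g) (hk : Measurable k) (hg2 : MemLp g 2 μ) (hk2 : MemLp k 2 μ)
    (hkm : Measurable (Function.uncurry fun (s : ℝ) (σ : ChainConfig) => k (D.flow s σ))) (a b : ℝ) :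
    Integrable (Function.uncurry fun (s : ℝ) (σ : ChainConfig) => g σ * k (D.flow s σ))
      ((volume.restrict (Set.Ioc a b)).prod μ) := by
  have hm : Measurable (Function.uncurry fun (s : ℝ) (σ : ChainConfig) => g σ * k (D.flow s σ)) :=
    (hg.comp measurable_snd).mul hkm
  refine (integrable_prod_iff hm.aestronglyMeasurable).2 ⟨Eventually.of_forall fun s => ?_, ?_⟩
  · exact hg2.integrable_mul (hk2.comp_measurePreserving (hD.2 s))
  · refine Integrable.mono' (integrable_const (((∫ σ, g σ ^ 2 ∂μ) + ∫ σ, k σ ^ 2 ∂μ) / 2))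
      hm.aestronglyMeasurable.norm.integral_prod_right' (Eventually.of_forall fun s => ?_)
    rw [Real.norm_eq_abs, abs_of_nonneg (integral_nonneg fun σ => norm_nonneg _)]
    simp only [Function.uncurry_apply_pair, Real.norm_eq_abs]
    exact tic_integral_abs_mul_comp_le (hD.2 s) hk hg2 hk2

/-- **Once-integrated local conservation law, in the mean.** For `g ∈ L²(μ)` and all `a, b`:
`∫ g (h_y ∘ φ_b − h_y ∘ φ_a) dμ = ∫_a^b (∫ g (j_{y−1} ∘ φ_s) dμ − ∫ g (j_y ∘ φ_s) dμ) ds`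
(pathwise `ḣ_y = j_{y−1} − j_y` on the carrier, FTC, Fubini). [folklore] -/
theorem tic_integral_mul_sub_energyDensityZ [IsFiniteMeasure μ] (hD : D.PreservesMeasure μ)
    (hUd : Differentiable ℝ P.U) (hVd : Differentiable ℝ P.V) (hVc : Continuous (deriv P.V))
    (hj2 : ∀ z : ℤ, MemLp (fun σ => P.bondCurrentZ σ z) 2 μ)
    (hJm : ∀ z : ℤ, Measurable
      (Function.uncurry fun (s : ℝ) (σ : ChainConfig) => P.bondCurrentZ (D.flow s σ) z))
    {g : ChainConfig → ℝ} (hg : Measurable g) (hg2 : MemLp g 2 μ) (y : ℤ) (a b : ℝ) :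
    ∫ σ, g σ * (P.energyDensityZ (D.flow b σ) y - P.energyDensityZ (D.flow a σ) y) ∂μ =
      ∫ s in a..b, ((∫ σ, g σ * P.bondCurrentZ (D.flow s σ) (y - 1) ∂μ) -
        ∫ σ, g σ * P.bondCurrentZ (D.flow s σ) y ∂μ) := by
  -- pathwise FTC on the carrier
  have hpath : ∀ σ ∈ D.carrier, P.energyDensityZ (D.flow b σ) y - P.energyDensityZ (D.flow a σ) y =
      ∫ s in a..b, (P.bondCurrentZ (D.flow s σ) (y - 1) - P.bondCurrentZ (D.flow s σ) y) := by
    intro σ hσ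
    exact (intervalIntegral.integral_eq_sub_of_hasDerivAt
      (fun s _ => (D.isSolution σ hσ).hasDerivAt_energyDensityZ hUd hVd y s)
      (((D.continuous_bondCurrentZ_flow hVc hσ (y - 1)).sub
        (D.continuous_bondCurrentZ_flow hVc hσ y)).intervalIntegrable a b)).symm
  have hint : ∀ (z : ℤ) (s : ℝ), Integrable (fun σ => g σ * P.bondCurrentZ (D.flow s σ) z) μ :=
    fun z s => hg2.integrable_mul ((hj2 z).comp_measurePreserving (hD.2 s))
  -- integrability on the product `uIoc a b × Ω`
  have hI : Integrable (Function.uncurry fun (s : ℝ) (σ : ChainConfig) =>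
      g σ * P.bondCurrentZ (D.flow s σ) (y - 1) - g σ * P.bondCurrentZ (D.flow s σ) y)
      ((volume.restrict (Set.uIoc a b)).prod μ) := by
    simp only [Set.uIoc]
    exact (tic_integrable_prod D hD hg (measurable_bondCurrentZ P (y - 1)) hg2 (hj2 (y - 1))
      (hJm (y - 1)) _ _).sub (tic_integrable_prod D hD hg (measurable_bondCurrentZ P y) hg2 (hj2 y)
      (hJm y) _ _)
  have hlhs : (fun σ => g σ * (P.energyDensityZ (D.flow b σ) y - P.energyDensityZ (D.flow a σ) y))
      =ᵐ[μ] fun σ => ∫ s in a..b,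
        (g σ * P.bondCurrentZ (D.flow s σ) (y - 1) - g σ * P.bondCurrentZ (D.flow s σ) y) := by
    filter_upwards [hD.1] with σ hσ
    rw [hpath σ hσ, ← intervalIntegral.integral_const_mul]
    simp only [mul_sub]
  rw [integral_congr_ae hlhs, ← intervalIntegral_integral_swap hI]
  refine intervalIntegral.integral_congr fun s _ => ?_
  exact integral_sub (hint (y - 1) s) (hint y s)

/-- Momentum reversal: `∫ (h_0 − c) j_y dμ = 0` when `μ` is `R`-invariant (`h` even, `j` odd). [folklore] -/
theorem tic_integral_energyDensityZ_sub_mul_bondCurrentZ (hR : MeasurePreserving chainReversal μ μ)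
    (hUm : Measurable P.U) (hVm : Measurable P.V) (c : ℝ) (y : ℤ) :
    ∫ σ, (P.energyDensityZ σ 0 - c) * P.bondCurrentZ σ y ∂μ = 0 := by
  have hm : Measurable fun σ => (P.energyDensityZ σ 0 - c) * P.bondCurrentZ σ y :=
    ((P.measurable_energyDensityZ hUm hVm 0).sub_const c).mul (measurable_bondCurrentZ P y)
  have h := integral_comp_eq_of_measurePreserving hR hm
  beta_reduce at h
  simp only [P.energyDensityZ_chainReversal, P.bondCurrentZ_chainReversal, mul_neg, integral_neg] at h
  linarith

/-- `∫ j_y (j_z ∘ φ_u) dμ = ∫ j_0 (j_{y−z} ∘ φ_{−u}) dμ` (stationarity + shift covariance). [folklore] -/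
theorem tic_integral_bondCurrentZ_mul_flow_swap (hD : D.PreservesMeasure μ)
    (hcar : D.carrier = P.bmGood)
    (hid : ∀ (t : ℝ) (σ : ChainConfig), σ ∉ P.bmGood → D.flow t σ = σ) (hSI : IsShiftInvariant μ)
    (hcomm : ∀ (t : ℝ) (x : ℤ), D.flow t ∘ chainShift x =ᵐ[μ] chainShift x ∘ D.flow t)
    (u : ℝ) (y z : ℤ) :
    ∫ σ, P.bondCurrentZ σ y * P.bondCurrentZ (D.flow u σ) z ∂μ =
      ∫ σ, P.bondCurrentZ σ 0 * P.bondCurrentZ (D.flow (-u) σ) (y - z) ∂μ := by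
  rw [tic_integral_mul_comp_flow_eq D hD hcar hid (measurable_bondCurrentZ P y)
    (measurable_bondCurrentZ P z) u, ← D.integral_bondCurrentZ_mul_flow_eq_of_shift hD hSI hcomm (-u) z y]
  exact integral_congr_ae (Eventually.of_forall fun σ => mul_comm _ _)

/-- **The twice-integrated conservation law** for a chain (`U, V ≥ 0` differentiable and measurable, `V'`
continuous), a dynamics with carrier `𝒳₀`, measurable flow, identity off `𝒳₀`, preserving a finite
shift- and reversal-invariant measure `μ` with `h_z, j_z ∈ L²(μ)`, an arbitrary centring constant `c`, and any
`G` agreeing pointwise with the (continuous) current pair correlations `∫ j_0 (j_z ∘ φ_u) dμ`: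
`∫ (h_0 − c)(h_x∘φ_t − c) − ∫ (h_0 − c)(h_x∘φ_0 − c) = ∫_{(0,t]} (t−u)(G(x+1,u) − 2G(x,u) + G(x−1,u)) du`. [folklore] -/
theorem tic_main [IsFiniteMeasure μ] (hD : D.PreservesMeasure μ) (hcar : D.carrier = P.bmGood)
    (hmeas : ∀ t : ℝ, Measurable (D.flow t))
    (hid : ∀ (t : ℝ) (σ : ChainConfig), σ ∉ P.bmGood → D.flow t σ = σ)
    (hU0 : ∀ r, 0 ≤ P.U r) (hV0 : ∀ r, 0 ≤ P.V r) (hUd : Differentiable ℝ P.U)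
    (hVd : Differentiable ℝ P.V) (hVc : Continuous (deriv P.V)) (hUm : Measurable P.U)
    (hVm : Measurable P.V) (hh2 : ∀ z : ℤ, MemLp (fun σ => P.energyDensityZ σ z) 2 μ)
    (hj2 : ∀ z : ℤ, MemLp (fun σ => P.bondCurrentZ σ z) 2 μ) (hSI : IsShiftInvariant μ)
    (hR : MeasurePreserving chainReversal μ μ) (G : ℤ → ℝ → ℝ)
    (hGap : ∀ (z : ℤ) (u : ℝ), G z u = ∫ σ, P.bondCurrentZ σ 0 * P.bondCurrentZ (D.flow u σ) z ∂μ)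
    (hGc : ∀ z : ℤ, Continuous (G z)) (c : ℝ) (x : ℤ) {t : ℝ} (ht : 0 ≤ t) :
    (∫ σ, (P.energyDensityZ σ 0 - c) * (P.energyDensityZ (D.flow t σ) x - c) ∂μ) -
      (∫ σ, (P.energyDensityZ σ 0 - c) * (P.energyDensityZ (D.flow 0 σ) x - c) ∂μ) =
      ∫ u in Set.Ioc (0:ℝ) t, (t - u) * (G (x + 1) u - 2 * G x u + G (x - 1) u) := by
  have hJm := tic_measurable_uncurry_bondCurrentZ_flow D hcar hmeas hid hVc
  have hcomm : ∀ (s : ℝ) (z : ℤ), D.flow s ∘ chainShift z =ᵐ[μ] chainShift z ∘ D.flow s :=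
    fun s z => Eventually.of_forall fun σ => D.flow_chainShift_of_eq_id hcar hid hU0 hV0 s z σ
  have hgm : Measurable fun σ => P.energyDensityZ σ 0 - c :=
    (P.measurable_energyDensityZ hUm hVm 0).sub_const c
  have hg2 : MemLp (fun σ => P.energyDensityZ σ 0 - c) 2 μ := (hh2 0).sub (memLp_const c)
  -- Step 3: the kernel identity `K(y,s) = ∫ (h_0 - c)(j_y ∘ φ_s) dμ = -∫₀ˢ (G(y+1,u) - G(y,u)) du`
  have hK : ∀ (y : ℤ) (s : ℝ), ∫ σ, (P.energyDensityZ σ 0 - c) * P.bondCurrentZ (D.flow s σ) y ∂μ =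
      -∫ u in (0:ℝ)..s, (G (y + 1) u - G y u) := by
    intro y s
    rw [tic_integral_mul_comp_flow_eq D hD hcar hid hgm (measurable_bondCurrentZ P y) s]
    have e : ∀ σ, (P.energyDensityZ (D.flow (-s) σ) 0 - c) * P.bondCurrentZ σ y =
        P.bondCurrentZ σ y * (P.energyDensityZ (D.flow (-s) σ) 0 - P.energyDensityZ (D.flow 0 σ) 0) +
          (P.energyDensityZ σ 0 - c) * P.bondCurrentZ σ y := by
      intro σ
      rw [D.flow_zero_of_eq_id hcar hid]
      ring
    have hi1 : Integrable (fun σ => P.bondCurrentZ σ y *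
        (P.energyDensityZ (D.flow (-s) σ) 0 - P.energyDensityZ (D.flow 0 σ) 0)) μ :=
      (hj2 y).integrable_mul (((hh2 0).comp_measurePreserving (hD.2 (-s))).sub
        ((hh2 0).comp_measurePreserving (hD.2 0)))
    have hi2 : Integrable (fun σ => (P.energyDensityZ σ 0 - c) * P.bondCurrentZ σ y) μ :=
      hg2.integrable_mul (hj2 y)
    have hA : ∀ u : ℝ, ∫ σ, P.bondCurrentZ σ y * P.bondCurrentZ (D.flow u σ) (0 - 1) ∂μ =
        G (y + 1) (-u) := fun u => by
      rw [tic_integral_bondCurrentZ_mul_flow_swap D hD hcar hid hSI hcomm,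
        show y - (0 - 1) = y + 1 by ring, hGap]
    have hB : ∀ u : ℝ, ∫ σ, P.bondCurrentZ σ y * P.bondCurrentZ (D.flow u σ) 0 ∂μ = G y (-u) :=
      fun u => by rw [tic_integral_bondCurrentZ_mul_flow_swap D hD hcar hid hSI hcomm, sub_zero, hGap]
    have hneg := intervalIntegral.integral_comp_neg (a := 0) (b := -s) (fun u => G (y + 1) u - G y u)
    simp only [neg_neg, neg_zero] at hneg
    rw [integral_congr_ae (Eventually.of_forall e), integral_add hi1 hi2,
      tic_integral_energyDensityZ_sub_mul_bondCurrentZ hR hUm hVm c y, add_zero,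
      tic_integral_mul_sub_energyDensityZ D hD hUd hVd hVc hj2 hJm (measurable_bondCurrentZ P y)
        (hj2 y) 0 0 (-s)]
    simp only [hA, hB]
    rw [hneg, intervalIntegral.integral_symm]
  -- Step 2: `S x t - S x 0 = ∫ (h_0 - c)(h_x ∘ φ_t - h_x ∘ φ_0) = ∫₀ᵗ (K(x-1,s) - K(x,s)) ds`
  have hit : ∀ s : ℝ, Integrable (fun σ => (P.energyDensityZ σ 0 - c) *
      (P.energyDensityZ (D.flow s σ) x - c)) μ := fun s =>
    hg2.integrable_mul (((hh2 x).comp_measurePreserving (hD.2 s)).sub (memLp_const c))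
  have e2 : ∀ σ, (P.energyDensityZ σ 0 - c) * (P.energyDensityZ (D.flow t σ) x - c) -
      (P.energyDensityZ σ 0 - c) * (P.energyDensityZ (D.flow 0 σ) x - c) =
      (P.energyDensityZ σ 0 - c) * (P.energyDensityZ (D.flow t σ) x - P.energyDensityZ (D.flow 0 σ) x) :=
    fun σ => by ring
  -- Step 4: `∫₀ᵗ ∫₀ˢ F = ∫₀ᵗ (t-u) F(u) du`
  have hGi : ∀ (z : ℤ) (s : ℝ), IntervalIntegrable (G z) volume 0 s := fun z s =>
    (hGc z).intervalIntegrable 0 s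
  have hF : ∀ s : ℝ, -(∫ u in (0:ℝ)..s, (G x u - G (x - 1) u)) - -(∫ u in (0:ℝ)..s, (G (x + 1) u - G x u)) =
      ∫ u in (0:ℝ)..s, (G (x + 1) u - 2 * G x u + G (x - 1) u) := by
    intro s
    rw [neg_sub_neg, ← intervalIntegral.integral_sub ((hGi (x + 1) s).sub (hGi x s))
      ((hGi x s).sub (hGi (x - 1) s))]
    refine intervalIntegral.integral_congr fun u _ => ?_
    ring
  have hFc : Continuous fun u => G (x + 1) u - 2 * G x u + G (x - 1) u :=
    ((hGc (x + 1)).sub (continuous_const.mul (hGc x))).add (hGc (x - 1))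
  rw [← integral_sub (hit t) (hit 0)]
  simp only [e2]
  rw [tic_integral_mul_sub_energyDensityZ D hD hUd hVd hVc hj2 hJm hgm hg2 x 0 t]
  simp only [hK, sub_add_cancel, hF]
  rw [tic_integral_integral_eq_integral_sub_mul hFc t, intervalIntegral.integral_of_le ht]

/-- STUB P `stub_twiceIntegratedContinuity` of line `Sketch` (crux `FibreCalculus`): the twice-integrated local
conservation law for the canonical dynamics of the pinned chain in a shift- and momentum-reversal-invariant DLR
state — with `h_x` the split-bond energy density, `S(x,t) = ∫(h_0 − ⟨h_0⟩)(h_x∘φ_t − ⟨h_0⟩)dμ` and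
`G(x,t) = ∫ j_0 (j_x∘φ_t) dμ`: `S(x,t) − S(x,0) = ∫_{(0,t]} (t−u)(G(x+1,u) − 2G(x,u) + G(x−1,u)) du` for
`t ≥ 0` (the local energy conservation of Bonetto–Lebowitz–Rey-Bellet 2000, §5.2 eq. (23), integrated twice
against the stationary state; specialisation of `tic_main`). -/
theorem stub_twiceIntegratedContinuity :
    ∀ ω₂ lam β γ : ℝ, 0 < ω₂ → 0 < lam → 0 < β → ∀ T : ℝ, 0 < T →
    ∀ μ : Measure ChainConfig, (pinnedChain ω₂ lam β γ).IsChainGibbsMeasure T μ → IsShiftInvariant μ →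
    μ.map (fun σ : ChainConfig => fun x : ℤ => ((σ x).1, -(σ x).2)) = μ →
    ∀ D : InfiniteChainDynamics (pinnedChain ω₂ lam β γ),
    D.carrier = (pinnedChain ω₂ lam β γ).bmGood → (∀ t : ℝ, Measurable (D.flow t)) →
    (∀ t : ℝ, ∀ σ ∉ (pinnedChain ω₂ lam β γ).bmGood, D.flow t σ = σ) →
    ∀ h : ChainConfig → ℤ → ℝ,
      h = (fun (σ : ChainConfig) (x : ℤ) => (σ x).2 ^ 2 / 2 + (pinnedChain ω₂ lam β γ).U (σ x).1 +
        ((pinnedChain ω₂ lam β γ).V ((σ (x + 1)).1 - (σ x).1) +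
          (pinnedChain ω₂ lam β γ).V ((σ x).1 - (σ (x - 1)).1)) / 2) →
    ∀ S : ℤ → ℝ → ℝ,
      S = (fun (x : ℤ) (t : ℝ) =>
        ∫ σ, (h σ 0 - ∫ σ', h σ' 0 ∂μ) * (h (D.flow t σ) x - ∫ σ', h σ' 0 ∂μ) ∂μ) →
    ∀ G : ℤ → ℝ → ℝ,
      G = (fun (x : ℤ) (t : ℝ) => ∫ σ, (pinnedChain ω₂ lam β γ).bondCurrentZ σ 0 *
        (pinnedChain ω₂ lam β γ).bondCurrentZ (D.flow t σ) x ∂μ) →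
    ∀ (x : ℤ) (t : ℝ), 0 ≤ t →
      S x t - S x 0 = ∫ u in Set.Ioc (0:ℝ) t, (t - u) * (G (x + 1) u - 2 * G x u + G (x - 1) u) := by
  intro ω₂ lam β γ hω hl hβ T hT μ hG hSI hRefl D hcar hmeas hid h hh S hS G hGdef x t ht
  have hU2 := OscillatorChain.pinnedChain_isEvenPolyOfDegree_U β γ hω.le hl
  have hV2 := OscillatorChain.pinnedChain_isEvenPolyOfDegree_V ω₂ lam γ hβ
  have hU0 := OscillatorChain.pinnedChain_U_nonneg β γ hω.le hl.le
  have hV0 := OscillatorChain.pinnedChain_V_nonneg ω₂ lam γ hβ.le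
  have hUm := OscillatorChain.measurable_pinnedChain_U ω₂ lam β γ
  have hVm := OscillatorChain.measurable_pinnedChain_V ω₂ lam β γ
  have hss := OscillatorChain.hasSuperstabilityEstimate_of_isShiftInvariant_pinnedChain γ hω hl.le
    hβ.le hT hG hSI
  haveI := hss.1
  have hD : D.PreservesMeasure μ := OscillatorChain.preservesMeasure_of_carrier_eq_bmGood
    one_le_two one_le_two hU2 hV2 D hcar hmeas hG hss
  have hhP : h = fun σ x => (pinnedChain ω₂ lam β γ).energyDensityZ σ x := hh
  subst hhP hS hGdef
  exact tic_main D hD hcar hmeas hid hU0 hV0 (hU2.contDiff_two.differentiable (by simp))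
    (hV2.contDiff_two.differentiable (by simp)) (hV2.contDiff_two.continuous_deriv (by norm_num))
    hUm hVm (fun z => hss.memLp_energyDensityZ hU0 hV0 hUm hVm z ENNReal.ofNat_ne_top)
    (fun z => hss.memLp_bondCurrentZ one_le_two hU0 hUm hV2 z ENNReal.ofNat_ne_top) hSI
    ⟨measurable_chainReversal, hRefl⟩ _ (fun _ _ => rfl)
    (fun z => InfiniteChainDynamics.continuous_integral_bondCurrentZ_mul_flow_pinnedChain γ hω.le
      hl.le hβ hss D hD z 0) _ x ht

end Summit.AtomisticToContinuum.FouriersLaw.Theorems.FibreCalculusSketch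

end
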